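import Summits.HubbardSuperconductivity.HubbardSuperconductivity.Theses.SpNLargeN

/-!
# Birth skeleton of piece `EndpointStability` = stmt-HubbardSuperconductivity-19076 (child of `SpnTarget`, stmt-HubbardSuperconductivity-1663; BC3)

Two named stubs and the kernel-checked composition `EndpointStability_of`:

* `stub_limitOfSimpleGroundState` (general finite-dimensional lemma, provable now, M-sized): if the
  `J = 0` sector ground state of the pure Hubbard torus at side `2(k+1)` is unique up to a scalar,
  then every unit ground state `φ` is the limit of unit `t-U-J` sector ground states along
  `J_n = 1/(n+1)`: pick ground states `ψ'_n` (they exist: Hermitian, sector-preserving, finite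
  dimension), phase-align them so that `⟨φ, ψ_n⟩ ≥ 0`; every subsequential limit is a unit `J = 0`
  ground state (closed condition; `minEnergyOn` is `‖B‖ J/4`-Lipschitz in `J`) hence `= c φ`,
  `|c| = 1`, `c ≥ 0`, so `c = 1`; compactness of the unit set gives convergence of the whole sequence.
* `stub_genericSimplicity` (crux-sized): for every doping and every open `U`-window there is `U` in
  the window such that at all large even sides the `(N_L, S^z = 0)` ground state of the pure Hubbard
  torus is SIMPLE. Stronger than what `EndpointStability` needs (an irreducible symmetry multiplet
  would do), but it is the cleanest sufficient condition; expected in the paired phase at large `L`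
  (all pairs condensed at zero momentum: `K = 0`, `S = 0`, gap `~ v_Δ/L` to two-quasiparticle states).
-/

set_option linter.dupNamespace false

namespace Summit.HubbardSuperconductivity.HubbardSuperconductivity.Cruxes.SpnTarget.VanishingExchange.BirthEndpointStability

open Matrix Filter Topology Literature.MathematicalPhysics.QuantumLattice

/-- Stub A — a simple endpoint ground state is a limit of `t-U-J` ground states (provable now). -/
theorem stub_limitOfSimpleGroundState :
    ∀ (U δ : ℝ) (k : ℕ), (∀ φ₁ φ₂ : Fock (Orb (FermionTorus 2 (2 * (k + 1)))), IsGroundStateInSector (hubbardTorus 2 (2 * (k + 1)) 1 U) (2 * ⌊(1 - δ) * (((2 * (k + 1)) : ℕ) : ℝ) ^ 2 / 2⌋₊) 0 φ₁ → IsGroundStateInSector (hubbardTorus 2 (2 * (k + 1)) 1 U) (2 * ⌊(1 - δ) * (((2 * (k + 1)) : ℕ) : ℝ) ^ 2 / 2⌋₊) 0 φ₂ → ∃ c : ℂ, φ₂ = c • φ₁) → ∀ φ : Fock (Orb (FermionTorus 2 (2 * (k + 1)))), star φ ⬝ᵥ φ = 1 → IsGroundStateInSector (hubbardTorus 2 (2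 * (k + 1)) 1 U) (2 * ⌊(1 - δ) * (((2 * (k + 1)) : ℕ) : ℝ) ^ 2 / 2⌋₊) 0 φ → ∃ (Js : ℕ → ℝ) (ψs : ℕ → Fock (Orb (FermionTorus 2 (2 * (k + 1))))), (∀ n, 0 < Js n) ∧ Filter.Tendsto Js Filter.atTop (nhds 0) ∧ (∀ n, star (ψs n) ⬝ᵥ ψs n = 1 ∧ IsGroundStateInSector (hubbardTorus 2 (2 * (k + 1)) 1 U - ((Js n / 4 : ℝ) : ℂ) • ∑ x : FermionTorus 2 (2 * (k + 1)), ∑ y : FermionTorus 2 (2 * (k + 1)), if (fermionTorusGraph 2 (2 * (k + 1))).Adj x y then (annihilation (orb x 0) * annihilation (orb y 1) - annihilation (orb x 1) * annihilation (orb y 0))ᴴ * (annihilation (orb x 0) * annihilation (orb y 1) - annihilation (orb x 1) * annihilation (orb y 0)) else 0) (2 * ⌊(1 - δ) * (((2 * (k + 1)) : ℕ) : ℝ) ^ 2 / 2⌋₊) 0 (ψs n)) ∧ Filter.Tendsto ψs Filter.atTop (nhds φ) := by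
  sorry

/-- Stub B — generic simplicity of the doped Hubbard torus ground state (crux-sized). -/
theorem stub_genericSimplicity :
    ∀ δ ∈ Set.Ioo (0:ℝ) (1/2), ∀ U₁ U₂ : ℝ, 0 ≤ U₁ → U₁ < U₂ → ∃ U ∈ Set.Ioo U₁ U₂, ∃ k₀ : ℕ, ∀ k : ℕ, k₀ ≤ k → ∀ φ₁ φ₂ : Fock (Orb (FermionTorus 2 (2 * (k + 1)))), IsGroundStateInSector (hubbardTorus 2 (2 * (k + 1)) 1 U) (2 * ⌊(1 - δ) * (((2 * (k + 1)) : ℕ) : ℝ) ^ 2 / 2⌋₊) 0 φ₁ → IsGroundStateInSector (hubbardTorus 2 (2 * (k + 1)) 1 U) (2 * ⌊(1 - δ) * (((2 * (k + 1)) : ℕ) : ℝ) ^ 2 / 2⌋₊) 0 φ₂ → ∃ c : ℂ, φ₂ = c • φ₁ := by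
  sorry

/-- Composition: (A) → (B) → `EndpointStability` (the child statement verbatim). -/
theorem endpointStability_of_pieces :
    (∀ (U δ : ℝ) (k : ℕ), (∀ φ₁ φ₂ : Fock (Orb (FermionTorus 2 (2 * (k + 1)))), IsGroundStateInSector (hubbardTorus 2 (2 * (k + 1)) 1 U) (2 * ⌊(1 - δ) * (((2 * (k + 1)) : ℕ) : ℝ) ^ 2 / 2⌋₊) 0 φ₁ → IsGroundStateInSector (hubbardTorus 2 (2 * (k + 1)) 1 U) (2 * ⌊(1 - δ) * (((2 * (k + 1)) : ℕ) : ℝ) ^ 2 / 2⌋₊) 0 φ₂ → ∃ c : ℂ, φ₂ = c • φ₁) → ∀ φ : Fock (Orb (FermionTorus 2 (2 * (k + 1)))), star φ ⬝ᵥ φ = 1 → IsGroundStateInSector (hubbardTorus 2 (2 * (k + 1)) 1 U) (2 * ⌊(1 - δ) * (((2 * (k + 1)) : ℕ) : ℝ) ^ 2 / 2⌋₊) 0 φ → ∃ (Js : ℕ → ℝ) (ψs : ℕ → Fock (Orb (FermionTorus 2 (2 * (k + 1))))), (∀ n, 0 < Js n) ∧ Filter.Tendsto Js Filter.atTop (nhds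 0) ∧ (∀ n, star (ψs n) ⬝ᵥ ψs n = 1 ∧ IsGroundStateInSector (hubbardTorus 2 (2 * (k + 1)) 1 U - ((Js n / 4 : ℝ) : ℂ) • ∑ x : FermionTorus 2 (2 * (k + 1)), ∑ y : FermionTorus 2 (2 * (k + 1)), if (fermionTorusGraph 2 (2 * (k + 1))).Adj x y then (annihilation (orb x 0) * annihilation (orb y 1) - annihilation (orb x 1) * annihilation (orb y 0))ᴴ * (annihilation (orb x 0) * annihilation (orb y 1) - annihilation (orb x 1) * annihilation (orb y 0)) else 0) (2 * ⌊(1 - δ) * (((2 * (k + 1)) : ℕ) : ℝ) ^ 2 / 2⌋₊) 0 (ψs n)) ∧ Filter.Tendsto ψs Filter.atTop (nhds φ)) →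
    (∀ δ ∈ Set.Ioo (0:ℝ) (1/2), ∀ U₁ U₂ : ℝ, 0 ≤ U₁ → U₁ < U₂ → ∃ U ∈ Set.Ioo U₁ U₂, ∃ k₀ : ℕ, ∀ k : ℕ, k₀ ≤ k → ∀ φ₁ φ₂ : Fock (Orb (FermionTorus 2 (2 * (k + 1)))), IsGroundStateInSector (hubbardTorus 2 (2 * (k + 1)) 1 U) (2 * ⌊(1 - δ) * (((2 * (k + 1)) : ℕ) : ℝ) ^ 2 / 2⌋₊) 0 φ₁ → IsGroundStateInSector (hubbardTorus 2 (2 * (k + 1)) 1 U) (2 * ⌊(1 - δ) * (((2 * (k + 1)) : ℕ) : ℝ) ^ 2 / 2⌋₊) 0 φ₂ → ∃ c : ℂ, φ₂ = c • φ₁) →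
    (∀ δ ∈ Set.Ioo (0:ℝ) (1/2), ∀ U₁ U₂ : ℝ, 0 ≤ U₁ → U₁ < U₂ → ∃ U ∈ Set.Ioo U₁ U₂, ∃ k₀ : ℕ, ∀ k : ℕ, k₀ ≤ k → ∀ φ : Fock (Orb (FermionTorus 2 (2 * (k + 1)))), star φ ⬝ᵥ φ = 1 → IsGroundStateInSector (hubbardTorus 2 (2 * (k + 1)) 1 U) (2 * ⌊(1 - δ) * ((2 * (k + 1) : ℕ) : ℝ) ^ 2 / 2⌋₊) 0 φ → ∃ (Js : ℕ → ℝ) (ψs : ℕ → Fock (Orb (FermionTorus 2 (2 * (k + 1))))), (∀ n, 0 < Js n) ∧ Filter.Tendsto Js Filter.atTop (nhds 0) ∧ (∀ n, star (ψs n) ⬝ᵥ ψs n = 1 ∧ IsGroundStateInSector (hubbardTorus 2 (2 * (k + 1)) 1 U - ((Js n / 4 : ℝ) : ℂ) • ∑ x : FermionTorus 2 (2 * (k + 1)), ∑ y : FermionTorus 2 (2 * (k + 1)), if (fermionTorusGraph 2 (2 * (k + 1))).Adj x y then (annihilation (orb x 0) * annihilation (orb y 1) - annihilation (orb x 1) *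 annihilation (orb y 0))ᴴ * (annihilation (orb x 0) * annihilation (orb y 1) - annihilation (orb x 1) * annihilation (orb y 0)) else 0) (2 * ⌊(1 - δ) * ((2 * (k + 1) : ℕ) : ℝ) ^ 2 / 2⌋₊) 0 (ψs n)) ∧ Filter.Tendsto ψs Filter.atTop (nhds φ)) := by
  intro hA hB δ hδ U₁ U₂ hU₁ hU₁₂
  obtain ⟨U, hU, k₀, hsimple⟩ := hB δ hδ U₁ U₂ hU₁ hU₁₂
  exact ⟨U, hU, k₀, fun k hk φ hφ hGS => hA U δ k (hsimple k hk) φ hφ hGS⟩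

/-- The piece BY NAME from its stubs: the route decl `EndpointStability`
(stmt-HubbardSuperconductivity-19076) unfolds to the conclusion of `endpointStability_of_pieces`. -/
theorem EndpointStability_of :
    Summit.HubbardSuperconductivity.HubbardSuperconductivity.Theses.SpNLargeN.EndpointStability :=
  endpointStability_of_pieces stub_limitOfSimpleGroundState stub_genericSimplicity

end Summit.HubbardSuperconductivity.HubbardSuperconductivity.Cruxes.SpnTarget.VanishingExchange.BirthEndpointStability
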